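import Literature.Analysis.Fourier.AnnulusCutoffSymbols
import Literature.Analysis.Fourier.LpMultiplierSchwartz
import HarnessLib

/-!
# Discharge of `isLpMultiplier_of_gradientLpBound`: an `Ẇ^{1,p}`-bounded bounded symbol is an
`Lᵖ` multiplier, `1 < p < ∞` (Rauch's step (6) and "multiply by `D_l/|D|` and sum on `l`")

`Literature.Analysis.Fourier.isLpMultiplier_of_gradientLpBound`
(`Literature/Analysis/Fourier/SobolevMultiplierBound.lean`, a named fact in the trust base of
`Literature.Barriers.AtomisticToContinuum.Rauch1986_L1GradientEstimate_imp_LpMultiplier`) is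
PROVED here (`isLpMultiplier_of_gradientLpBound_holds`), from the tree's proof of the
`Lᵖ`-boundedness of the Riesz transforms (`rieszTransform_isLpMultiplier_holds`,
`SobolevMultiplierBoundProofs.lean`).

Printed argument [Rauch1986, Proof of Theorem p. 483]: with `ψ = |D|χ`, (6)
`‖D_l M^{αβ}(D)|D|⁻¹ψ‖_{Lᵖ} ≤ c Σⱼ‖Dⱼ|D|⁻¹ψ‖_{Lᵖ}`; the Riesz transforms `Dⱼ/|D|` are bounded
on `Lᵖ`, `|D|C₀^∞` is dense, and "to show that `M(D)` is itself bounded, multiply by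
`D_l/|D| ∈ Hom(Lᵖ)` and sum on `l`". As formalised (avoiding the density of `|D|C₀^∞` and
unbounded symbols): for a Schwartz `ψ` and the annular Fourier cut-offs `ρ_n`
(`AnnulusCutoffSymbols.lean`) put `ψ_n = ρ_n(D)ψ`, `φ_{n,j} = 𝓕⁻¹(a_{n,j}ψ̂)`,
`θ_{n,j} = 𝓕⁻¹(b_{n,j}ψ̂)` (all Schwartz). Then `ψ_n = Σⱼ ∂ⱼφ_{n,j}`
(`multiplierOp_psiN_eq_sum`), `∂_lφ_{n,j} = -R_lθ_{n,j}` (`partialDeriv_phiN_eq`) and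
`θ_{n,j} = Rⱼψ_n` (`coe_thetaN_eq`), so the `Ẇ^{1,p}` bound (extended to Schwartz test
functions in `GradientBoundSchwartz.lean`) and two applications of the Riesz bound give
`‖M(D)ψ_n‖_p ≤ K‖ψ_n‖_p ≤ K'‖ψ‖_p` uniformly in `n` (`eLpNorm_multiplierOp_psiN_le`;
`‖ψ_n‖_p ≤ 2‖𝓕⁻¹β‖₁‖ψ‖_p` by Young); finally `M(D)ψ_n → M(D)ψ` pointwise (dominated
convergence on the Fourier side, `ρ_n → 1` off the origin) and Fatou. Dimension `d = 0` (where
the hypothesis is void) is the trivial bound on a one-point space.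

## References

* [Rauch1986] J. Rauch, Comm. Math. Phys. 106 (1986) 481–484, Proof of Theorem p. 483, (6).
* [Grafakos2014] L. Grafakos, *Classical Fourier Analysis*, 3rd ed. (2014), Prop. 5.1.14,
  Prop. 5.1.16, Cor. 5.2.8, Prop. 2.5.13.
-/

noncomputable section

open MeasureTheory FourierTransform Filter Topology
open scoped SchwartzMap ENNReal NNReal ContDiff RealInnerProductSpace

namespace Literature.Analysis.Fourier

variable {d k k' : ℕ}

/-! ### `𝓕⁻` of finite sums -/

variable {V : Type*} [NormedAddCommGroup V] [InnerProductSpace ℝ V] [FiniteDimensional ℝ V]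
  [MeasurableSpace V] [BorelSpace V]

/-- `𝓕⁻ (Σᵢ Gᵢ) = Σᵢ 𝓕⁻ Gᵢ` for integrable `Gᵢ`. [folklore] -/
theorem fourierInv_finset_sum {E : Type*} [NormedAddCommGroup E] [NormedSpace ℂ E] [CompleteSpace E]
    {σ : Type*} (s : Finset σ) {G : σ → V → E} (hG : ∀ i ∈ s, Integrable (G i)) :
    𝓕⁻ (∑ i ∈ s, G i) = ∑ i ∈ s, 𝓕⁻ (G i) := by
  classical
  induction s using Finset.induction_on with
  | empty => simp [fourierInv_zero']
  | insert a s ha ih =>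
    rw [Finset.sum_insert ha, Finset.sum_insert ha,
      fourierInv_add' (hG a (Finset.mem_insert_self a s))
        (integrable_finsetSum' _ fun i hi => hG i (Finset.mem_insert_of_mem hi)),
      ih fun i hi => hG i (Finset.mem_insert_of_mem hi)]

/-! ### The three Schwartz test functions of step (6) -/

/-- `ψ_n = ρ_n(D)ψ`. [cite: Rauch1986, Proof of Theorem p. 483, (6)] -/
def psiN (n : ℕ) (ψ : 𝓢(EuclideanSpace ℝ (Fin d), Fin k → ℂ)) :
    𝓢(EuclideanSpace ℝ (Fin d), Fin k → ℂ) :=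
  SchwartzMap.fourierMultiplierCLM (Fin k → ℂ) (⇑(rhoSymbol d n)) ψ

/-- `φ_{n,j} = 𝓕⁻¹(a_{n,j} ψ̂)` (so that `Σⱼ ∂ⱼφ_{n,j} = ψ_n`).
[cite: Rauch1986, Proof of Theorem p. 483, (6)] -/
def phiN (n : ℕ) (j : Fin d) (ψ : 𝓢(EuclideanSpace ℝ (Fin d), Fin k → ℂ)) :
    𝓢(EuclideanSpace ℝ (Fin d), Fin k → ℂ) :=
  SchwartzMap.fourierMultiplierCLM (Fin k → ℂ) (⇑(aSymbol n j)) ψ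

/-- `θ_{n,j} = 𝓕⁻¹(b_{n,j} ψ̂) = Rⱼψ_n`. [cite: Rauch1986, Proof of Theorem p. 483, (6)] -/
def thetaN (n : ℕ) (j : Fin d) (ψ : 𝓢(EuclideanSpace ℝ (Fin d), Fin k → ℂ)) :
    𝓢(EuclideanSpace ℝ (Fin d), Fin k → ℂ) :=
  SchwartzMap.fourierMultiplierCLM (Fin k → ℂ) (⇑(bSymbol n j)) ψ

/-- A Schwartz function is the inverse Fourier integral of its Fourier transform. [folklore] -/
theorem coe_eq_fourierInv_fourier (h : 𝓢(EuclideanSpace ℝ (Fin d), Fin k → ℂ)) :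
    (⇑h : EuclideanSpace ℝ (Fin d) → Fin k → ℂ) = 𝓕⁻ (𝓕 (⇑h)) := by
  have := h.continuous.fourierInv_fourier_eq h.integrable
    (by rw [← SchwartzMap.fourier_coe]; exact (𝓕 h).integrable)
  exact this.symm

/-- **`M(D)ψ_n = Σⱼ M(D)∂ⱼφ_{n,j}`** (`Σⱼ 2πiξⱼa_{n,j} = ρ_n`).
[cite: Rauch1986, Proof of Theorem p. 483, (6)] -/
theorem multiplierOp_psiN_eq_sum {M : EuclideanSpace ℝ (Fin d) → Matrix (Fin k') (Fin k) ℂ}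
    (hM : ∀ a b, Measurable fun ξ => M ξ a b) {C₀ : ℝ} (hC0 : 0 ≤ C₀)
    (hC : ∀ ξ a b, ‖M ξ a b‖ ≤ C₀) (n : ℕ) (ψ : 𝓢(EuclideanSpace ℝ (Fin d), Fin k → ℂ)) :
    multiplierOp M ⇑(psiN n ψ) =
      ∑ j, multiplierOp M (partialDeriv j ⇑(phiN n j ψ)) := by
  -- each summand as `𝓕⁻` of an integrable function
  open LineDeriv in
  set G : Fin d → EuclideanSpace ℝ (Fin d) → Fin k' → ℂ := fun j ξ =>
    (M ξ).mulVec (𝓕 (partialDeriv j ⇑(phiN n j ψ)) ξ) with hGdef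
  have hGint : ∀ j, Integrable (G j) := fun j => by
    have : partialDeriv j ⇑(phiN n j ψ) =
        ⇑(∂_{EuclideanSpace.single j (1 : ℝ)} (phiN n j ψ) :
          𝓢(EuclideanSpace ℝ (Fin d), Fin k → ℂ)) := rfl
    rw [hGdef]; dsimp only; rw [this]
    exact integrable_mulVec_fourier hM hC0 hC _
  have hsum : ∑ j, multiplierOp M (partialDeriv j ⇑(phiN n j ψ)) = 𝓕⁻ (∑ j, G j) := by
    rw [fourierInv_finset_sum _ fun j _ => hGint j]
    rfl
  rw [hsum, multiplierOp_apply]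
  congr 1
  funext ξ
  rw [Finset.sum_apply]
  simp only [hGdef, fourier_partialDeriv_schwartz, phiN, fourier_coe_fourierMultiplierCLM_schwartz,
    psiN]
  rw [← Matrix.mulVec_sum]
  congr 1
  simp_rw [smul_smul]
  rw [← Finset.sum_smul, sum_deriv_mul_aSymbol]

/-- **`∂_lφ_{n,j} = -R_lθ_{n,j}`** (`2πiξ_la_{n,j} = -r_lb_{n,j}`).
[cite: Grafakos2014, Prop. 5.1.14] -/
theorem partialDeriv_phiN_eq (n : ℕ) (j l : Fin d) (ψ : 𝓢(EuclideanSpace ℝ (Fin d), Fin k → ℂ)) :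
    partialDeriv l ⇑(phiN n j ψ) =
      -multiplierOp (fun ξ => rieszSymbol l ξ • (1 : Matrix (Fin k) (Fin k) ℂ))
        ⇑(thetaN n j ψ) := by
  open LineDeriv in
  have h1 : partialDeriv l ⇑(phiN n j ψ) =
      ⇑(∂_{EuclideanSpace.single l (1 : ℝ)} (phiN n j ψ) :
        𝓢(EuclideanSpace ℝ (Fin d), Fin k → ℂ)) := rfl
  rw [h1, coe_eq_fourierInv_fourier, ← h1, multiplierOp_apply, ← neg_one_smul ℂ (𝓕⁻ _),
    ← fourierInv_const_smul']
  congr 1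
  funext ξ
  rw [fourier_partialDeriv_schwartz, phiN, fourier_coe_fourierMultiplierCLM_schwartz, Pi.smul_apply,
    thetaN, fourier_coe_fourierMultiplierCLM_schwartz]
  simp only [Matrix.smul_mulVec, Matrix.one_mulVec, smul_smul, neg_one_mul]
  rw [deriv_mul_aSymbol_eq]

/-- **`θ_{n,j} = Rⱼψ_n`** (`b_{n,j} = ρ_n rⱼ`). [cite: Grafakos2014, Prop. 5.1.14] -/
theorem coe_thetaN_eq (n : ℕ) (j : Fin d) (ψ : 𝓢(EuclideanSpace ℝ (Fin d), Fin k → ℂ)) :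
    (⇑(thetaN n j ψ) : EuclideanSpace ℝ (Fin d) → Fin k → ℂ) =
      multiplierOp (fun ξ => rieszSymbol j ξ • (1 : Matrix (Fin k) (Fin k) ℂ)) ⇑(psiN n ψ) := by
  rw [thetaN, coe_fourierMultiplierCLM_schwartz, multiplierOp_apply]
  congr 1
  funext ξ
  rw [psiN, fourier_coe_fourierMultiplierCLM_schwartz]
  simp only [Matrix.smul_mulVec, Matrix.one_mulVec, smul_smul, bSymbol_apply, rhoSymbol_apply,
    mul_comm]

/-- **`‖ψ_n‖_p ≤ 2‖𝓕⁻¹β‖_{L¹} ‖ψ‖_p`**, `1 ≤ p < ∞` (Young). [cite: Grafakos2014, Prop. 2.5.13] -/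
theorem eLpNorm_psiN_le (n : ℕ) (ψ : 𝓢(EuclideanSpace ℝ (Fin d), Fin k → ℂ)) {p : ℝ≥0∞}
    (hp1 : 1 ≤ p) (hp : p ≠ ⊤) :
    eLpNorm (⇑(psiN n ψ)) p volume ≤
      (2 * ∫⁻ x, ‖𝓕⁻ (⇑(bumpSchwartz d)) x‖ₑ) * eLpNorm (⇑ψ) p volume := by
  classical
  have h := (isLpMultiplierWith_smul_one_schwartz (ι := Fin k) (rhoSymbol d n) hp1 hp).bound ψ
  rw [← coe_fourierMultiplierCLM_schwartz_eq_multiplierOp] at h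
  refine h.trans (mul_le_mul_left ?_ _)
  have hfin : (∫⁻ t, ‖(𝓕⁻ (rhoSymbol d n) : 𝓢(EuclideanSpace ℝ (Fin d), ℂ)) t‖ₑ) ≠ ⊤ :=
    (𝓕⁻ (rhoSymbol d n) : 𝓢(EuclideanSpace ℝ (Fin d), ℂ)).integrable.hasFiniteIntegral.ne
  rw [ENNReal.coe_toNNReal hfin, SchwartzMap.fourierInv_coe]
  exact lintegral_enorm_fourierInv_rhoSymbol_le n

/-! ### The uniform bound `‖M(D)ψ_n‖_p ≤ K ‖ψ‖_p` -/

/-- **Step (6) as formalised: `‖M(D)ψ_n‖_p ≤ K‖ψ‖_p` uniformly in `n`**, with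
`K = c · (Σ_l C_l)² · 2‖𝓕⁻¹β‖₁`, `C_l` the Riesz constants, for a bounded measurable symbol with
the `Ẇ^{1,p}` bound `c` and `1 < p < ∞`. [cite: Rauch1986, Proof of Theorem p. 483, (6)] -/
theorem eLpNorm_multiplierOp_psiN_le {M : EuclideanSpace ℝ (Fin d) → Matrix (Fin k') (Fin k) ℂ}
    (hM : ∀ a b, Measurable fun ξ => M ξ a b) {C₀ : ℝ≥0} (hC : ∀ ξ a b, ‖M ξ a b‖ ≤ C₀)
    {p : ℝ≥0∞} (hp1 : 1 < p) (hp2 : p < ⊤) {c : ℝ≥0} (hW : HasGradientLpBoundWith p c M)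
    {CR : Fin d → ℝ≥0}
    (hR : ∀ l,
      IsLpMultiplierWith p (CR l) (fun ξ => rieszSymbol l ξ • (1 : Matrix (Fin k) (Fin k) ℂ)))
    (n : ℕ) (ψ : 𝓢(EuclideanSpace ℝ (Fin d), Fin k → ℂ)) :
    eLpNorm (multiplierOp M ⇑(psiN n ψ)) p volume ≤
      (c * ((∑ l, CR l) * (∑ l, CR l)) : ℝ≥0) * ((2 * ∫⁻ x, ‖𝓕⁻ (⇑(bumpSchwartz d)) x‖ₑ) *
        eLpNorm (⇑ψ) p volume) := by
  have hC0 : (0 : ℝ) ≤ C₀ := C₀.coe_nonneg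
  have hp := hp2.ne
  set B : ℝ≥0∞ := 2 * ∫⁻ x, ‖𝓕⁻ (⇑(bumpSchwartz d)) x‖ₑ with hB
  set S : ℝ≥0 := ∑ l, CR l with hS
  -- (a) `M(D)ψ_n = Σⱼ M(D)∂ⱼφ_{n,j}`, Minkowski
  open LineDeriv in
  have hmeas : ∀ j,
      AEStronglyMeasurable (multiplierOp M (partialDeriv j ⇑(phiN n j ψ))) volume := by
    intro j
    have : partialDeriv j ⇑(phiN n j ψ) =
        ⇑(∂_{EuclideanSpace.single j (1 : ℝ)} (phiN n j ψ) :
          𝓢(EuclideanSpace ℝ (Fin d), Fin k → ℂ)) := rfl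
    rw [this]
    exact (continuous_multiplierOp_schwartz hM hC0 hC _).aestronglyMeasurable
  have h1 : eLpNorm (multiplierOp M ⇑(psiN n ψ)) p volume ≤
      ∑ j, eLpNorm (multiplierOp M (partialDeriv j ⇑(phiN n j ψ))) p volume := by
    rw [multiplierOp_psiN_eq_sum hM hC0 hC n ψ]
    exact eLpNorm_sum_le (fun j _ => hmeas j) hp1.le
  -- (b) the `Ẇ^{1,p}` bound on the Schwartz functions `φ_{n,j}`
  have h2 : ∀ j, eLpNorm (multiplierOp M (partialDeriv j ⇑(phiN n j ψ))) p volume ≤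
      c * ∑ l, eLpNorm (partialDeriv l ⇑(phiN n j ψ)) p volume := fun j =>
    hW.eLpNorm_multiplierOp_partialDeriv_schwartz_le hM hC hp1.le hp (phiN n j ψ) j
  -- (c) `∂_lφ_{n,j} = -R_lθ_{n,j}` and the Riesz bound
  have h3 : ∀ j l, eLpNorm (partialDeriv l ⇑(phiN n j ψ)) p volume ≤
      CR l * eLpNorm (⇑(thetaN n j ψ)) p volume := by
    intro j l
    rw [partialDeriv_phiN_eq, eLpNorm_neg]
    exact (hR l).bound (thetaN n j ψ)
  -- (d) `θ_{n,j} = Rⱼψ_n` and the Riesz bound again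
  have h4 : ∀ j, eLpNorm (⇑(thetaN n j ψ)) p volume ≤ CR j * eLpNorm (⇑(psiN n ψ)) p volume := by
    intro j
    rw [coe_thetaN_eq]
    exact (hR j).bound (psiN n ψ)
  -- (e) `‖ψ_n‖_p ≤ B‖ψ‖_p`
  have h5 : eLpNorm (⇑(psiN n ψ)) p volume ≤ B * eLpNorm (⇑ψ) p volume :=
    eLpNorm_psiN_le n ψ hp1.le hp
  -- assemble
  calc eLpNorm (multiplierOp M ⇑(psiN n ψ)) p volume
      ≤ ∑ j, eLpNorm (multiplierOp M (partialDeriv j ⇑(phiN n j ψ))) p volume := h1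
    _ ≤ ∑ j, (c : ℝ≥0∞) * ∑ l, eLpNorm (partialDeriv l ⇑(phiN n j ψ)) p volume :=
        Finset.sum_le_sum fun j _ => h2 j
    _ ≤ ∑ j, (c : ℝ≥0∞) * ∑ l, (CR l : ℝ≥0∞) * ((CR j : ℝ≥0∞) * (B * eLpNorm (⇑ψ) p volume)) := by
        refine Finset.sum_le_sum fun j _ => mul_le_mul_right (Finset.sum_le_sum fun l _ => ?_) _
        exact (h3 j l).trans (mul_le_mul_right ((h4 j).trans (mul_le_mul_right h5 _)) _)
    _ = ∑ j, ((c : ℝ≥0∞) * (∑ l, (CR l : ℝ≥0∞)) * (B * eLpNorm (⇑ψ) p volume)) * (CR j : ℝ≥0∞) := by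
        refine Finset.sum_congr rfl fun j _ => ?_
        rw [← Finset.sum_mul]
        ring
    _ = ((c : ℝ≥0∞) * (∑ l, (CR l : ℝ≥0∞)) * (B * eLpNorm (⇑ψ) p volume)) * ∑ j, (CR j : ℝ≥0∞) :=
        (Finset.mul_sum Finset.univ (fun j => (CR j : ℝ≥0∞)) _).symm
    _ = (c * (S * S) : ℝ≥0) * (B * eLpNorm (⇑ψ) p volume) := by
        rw [hS]
        push_cast
        ring

/-! ### The limit `n → ∞` -/

/-- **`M(D)ψ_n → M(D)ψ` pointwise** (`d ≥ 1`): `𝓕ψ_n = ρ_n𝓕ψ → 𝓕ψ` in `L¹` by dominated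
convergence (`|ρ_n| ≤ 1`, `ρ_n → 1` off the origin), and `‖𝓕⁻¹G‖_∞ ≤ ‖G‖₁`. [folklore] -/
theorem tendsto_multiplierOp_psiN [Nontrivial (EuclideanSpace ℝ (Fin d))]
    {M : EuclideanSpace ℝ (Fin d) → Matrix (Fin k') (Fin k) ℂ}
    (hM : ∀ a b, Measurable fun ξ => M ξ a b) {C₀ : ℝ} (hC0 : 0 ≤ C₀)
    (hC : ∀ ξ a b, ‖M ξ a b‖ ≤ C₀) (ψ : 𝓢(EuclideanSpace ℝ (Fin d), Fin k → ℂ))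
    (x : EuclideanSpace ℝ (Fin d)) :
    Tendsto (fun n => multiplierOp M ⇑(psiN n ψ) x) atTop (𝓝 (multiplierOp M ⇑ψ x)) := by
  set F : EuclideanSpace ℝ (Fin d) → Fin k' → ℂ := fun ξ => (M ξ).mulVec (𝓕 (⇑ψ) ξ) with hF
  set Fn : ℕ → EuclideanSpace ℝ (Fin d) → Fin k' → ℂ := fun n ξ =>
    (M ξ).mulVec (𝓕 (⇑(psiN n ψ)) ξ) with hFn
  have hFint : Integrable F := integrable_mulVec_fourier hM hC0 hC ψ
  have hFnint : ∀ n, Integrable (Fn n) := fun n => integrable_mulVec_fourier hM hC0 hC (psiN n ψ)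
  -- `∫ ‖F_n - F‖ → 0`
  have hdiff : ∀ n ξ, Fn n ξ - F ξ =
      (M ξ).mulVec ((((annulusCutoff d n ξ : ℝ) : ℂ) - 1) • 𝓕 (⇑ψ) ξ) := by
    intro n ξ
    simp only [hFn, hF, psiN, fourier_coe_fourierMultiplierCLM_schwartz, rhoSymbol_apply]
    rw [← Matrix.mulVec_sub, sub_smul, one_smul]
  have hL1 : Tendsto (fun n => ∫ ξ, ‖Fn n ξ - F ξ‖) atTop (𝓝 0) := by
    have hbound : ∀ n, ∀ᵐ ξ ∂(volume : Measure (EuclideanSpace ℝ (Fin d))),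
        ‖‖Fn n ξ - F ξ‖‖ ≤ Fintype.card (Fin k) * C₀ * (2 * ‖𝓕 (⇑ψ) ξ‖) := by
      intro n
      refine Eventually.of_forall fun ξ => ?_
      rw [norm_norm, hdiff]
      refine (norm_mulVec_le_of_entry_le hC0 (hC ξ) _).trans ?_
      refine mul_le_mul_of_nonneg_left ?_ (by positivity)
      rw [norm_smul]
      refine mul_le_mul_of_nonneg_right ?_ (norm_nonneg _)
      calc ‖(((annulusCutoff d n ξ : ℝ) : ℂ) - 1)‖
          ≤ ‖((annulusCutoff d n ξ : ℝ) : ℂ)‖ + ‖(1 : ℂ)‖ := norm_sub_le _ _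
        _ ≤ 1 + 1 := by
            rw [Complex.norm_real, norm_one, Real.norm_eq_abs]
            exact add_le_add (abs_annulusCutoff_le n ξ) le_rfl
        _ = 2 := by norm_num
    have hint : Integrable fun ξ => Fintype.card (Fin k) * C₀ * (2 * ‖𝓕 (⇑ψ) ξ‖) := by
      have := ((𝓕 ψ).integrable (μ := volume)).norm.const_mul (Fintype.card (Fin k) * C₀ * 2)
      refine this.congr (Eventually.of_forall fun ξ => ?_)
      simp only [SchwartzMap.fourier_coe]
      ring
    have hlim : ∀ᵐ ξ ∂(volume : Measure (EuclideanSpace ℝ (Fin d))),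
        Tendsto (fun n => ‖Fn n ξ - F ξ‖) atTop (𝓝 0) := by
      filter_upwards [ae_ne_zero (E := EuclideanSpace ℝ (Fin d))] with ξ hξ
      refine tendsto_const_nhds.congr' ?_
      filter_upwards [eventually_annulusCutoff_eq_one (d := d) hξ] with n hn
      rw [hdiff, hn, Complex.ofReal_one, sub_self, zero_smul, Matrix.mulVec_zero, norm_zero]
    have hmeas : ∀ n, AEStronglyMeasurable (fun ξ => ‖Fn n ξ - F ξ‖) volume := fun n =>
      ((hFnint n).sub hFint).aestronglyMeasurable.norm
    have := tendsto_integral_of_dominated_convergence _ hmeas hint hbound hlim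
    simpa using this
  -- `‖𝓕⁻(F_n - F) x‖ ≤ ∫ ‖F_n - F‖`
  have hle : ∀ n, ‖multiplierOp M ⇑(psiN n ψ) x - multiplierOp M ⇑ψ x‖ ≤ ∫ ξ, ‖Fn n ξ - F ξ‖ := by
    intro n
    rw [multiplierOp_apply, multiplierOp_apply, ← Pi.sub_apply (𝓕⁻ (Fn n)),
      ← fourierInv_sub' (hFnint n) hFint]
    exact VectorFourier.norm_fourierIntegral_le_integral_norm _ _ _ _ _
  rw [tendsto_iff_norm_sub_tendsto_zero]
  exact tendsto_of_tendsto_of_tendsto_of_le_of_le tendsto_const_nhds hL1 (fun n => norm_nonneg _)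
    hle

/-- **The case `d ≥ 1`**: `M` is an `Lᵖ` multiplier with the constant of
`eLpNorm_multiplierOp_psiN_le` (Fatou). [cite: Rauch1986, Proof of Theorem p. 483, (6)] -/
theorem isLpMultiplierWith_of_gradientLpBound [Nontrivial (EuclideanSpace ℝ (Fin d))]
    {M : EuclideanSpace ℝ (Fin d) → Matrix (Fin k') (Fin k) ℂ}
    (hM : ∀ a b, Measurable fun ξ => M ξ a b) {C₀ : ℝ≥0} (hC : ∀ ξ a b, ‖M ξ a b‖ ≤ C₀)
    {p : ℝ≥0∞} (hp1 : 1 < p) (hp2 : p < ⊤) {c : ℝ≥0} (hW : HasGradientLpBoundWith p c M)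
    {CR : Fin d → ℝ≥0}
    (hR : ∀ l,
      IsLpMultiplierWith p (CR l) (fun ξ => rieszSymbol l ξ • (1 : Matrix (Fin k) (Fin k) ℂ))) :
    IsLpMultiplierWith p
      ((c * ((∑ l, CR l) * (∑ l, CR l))) * (2 * ∫⁻ x, ‖𝓕⁻ (⇑(bumpSchwartz d)) x‖ₑ).toNNReal) M := by
  have hC0 : (0 : ℝ) ≤ C₀ := C₀.coe_nonneg
  have hBfin : (2 * ∫⁻ x, ‖𝓕⁻ (⇑(bumpSchwartz d)) x‖ₑ) ≠ ⊤ :=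
    ENNReal.mul_ne_top (by norm_num) (lintegral_enorm_fourierInv_bumpSchwartz_lt_top d).ne
  refine ⟨fun f => integrable_mulVec_fourier hM hC0 hC f, fun ψ => ?_⟩
  have hFatou : eLpNorm (multiplierOp M ⇑ψ) p volume ≤
      atTop.liminf fun n => eLpNorm (multiplierOp M ⇑(psiN n ψ)) p volume :=
    Lp.eLpNorm_lim_le_liminf_eLpNorm
      (fun n => (continuous_multiplierOp_schwartz hM hC0 hC (psiN n ψ)).aestronglyMeasurable)
      (multiplierOp M ⇑ψ) (Eventually.of_forall fun x => tendsto_multiplierOp_psiN hM hC0 hC ψ x)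
  refine hFatou.trans ?_
  have hbound := fun n => eLpNorm_multiplierOp_psiN_le hM hC hp1 hp2 hW hR n ψ
  refine (liminf_le_liminf (Eventually.of_forall hbound)).trans (le_of_eq ?_)
  rw [liminf_const, ENNReal.coe_mul (c * ((∑ l, CR l) * (∑ l, CR l))), ENNReal.coe_toNNReal hBfin]
  ring

/-! ### Dimension zero -/

/-- On `ℝ⁰` (a point, unit mass) every bounded symbol is an `Lᵖ` multiplier:
`M(D)f = M(0)f`. [folklore] -/
theorem isLpMultiplierWith_of_finrank_zero
    {M : EuclideanSpace ℝ (Fin 0) → Matrix (Fin k') (Fin k) ℂ}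
    (hM : ∀ a b, Measurable fun ξ => M ξ a b) {C₀ : ℝ≥0} (hC : ∀ ξ a b, ‖M ξ a b‖ ≤ C₀)
    (p : ℝ≥0∞) : IsLpMultiplierWith p (Fintype.card (Fin k) * C₀) M := by
  have hC0 : (0 : ℝ) ≤ C₀ := C₀.coe_nonneg
  refine ⟨fun f => integrable_mulVec_fourier hM hC0 hC f, fun f => ?_⟩
  -- all Fourier integrals are evaluations at the single point `0`
  have hF : ∀ {E : Type} [NormedAddCommGroup E] [NormedSpace ℂ E] [CompleteSpace E]
      (g : EuclideanSpace ℝ (Fin 0) → E) (ξ : EuclideanSpace ℝ (Fin 0)), 𝓕 g ξ = g 0 := by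
    intro E _ _ _ g ξ
    rw [Real.fourier_eq, volume_euclideanSpace_eq_dirac, integral_dirac]
    simp
  have hFi : ∀ {E : Type} [NormedAddCommGroup E] [NormedSpace ℂ E] [CompleteSpace E]
      (g : EuclideanSpace ℝ (Fin 0) → E) (ξ : EuclideanSpace ℝ (Fin 0)), 𝓕⁻ g ξ = g 0 := by
    intro E _ _ _ g ξ
    rw [Real.fourierInv_eq, volume_euclideanSpace_eq_dirac, integral_dirac]
    simp
  have hop : multiplierOp M ⇑f = fun x => (M x).mulVec (f x) := by
    funext x
    rw [multiplierOp_apply, hFi, hF, Subsingleton.elim x 0]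
  rw [hop]
  have hpt : ∀ x, ‖(M x).mulVec (f x)‖₊ ≤ (Fintype.card (Fin k) * C₀ : ℝ≥0) * ‖f x‖₊ := fun x => by
    rw [← NNReal.coe_le_coe]
    push_cast
    exact norm_mulVec_le_of_entry_le hC0 (hC x) (f x)
  have := eLpNorm_le_nnreal_smul_eLpNorm_of_ae_le_mul (Eventually.of_forall hpt) p (μ := volume)
  simpa [ENNReal.smul_def, smul_eq_mul] using this

/-! ### The discharge -/

/-- **Discharge of `isLpMultiplier_of_gradientLpBound`** ("multiply by `D_l/|D| ∈ Hom(Lᵖ)` and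
sum on `l`" [Rauch1986, p. 483]): a bounded, entrywise measurable matrix symbol on `ℝᵈ` whose
multiplier operator obeys an `Ẇ^{1,p}` bound on `C_c^∞`, `1 < p < ∞`, is an `Lᵖ` Fourier
multiplier. Inputs: the Riesz transforms are `Lᵖ` multipliers
(`rieszTransform_isLpMultiplier_holds`, proved in the tree by Calderón–Zygmund theory), the
extension of the bound to Schwartz test functions (`GradientBoundSchwartz.lean`), the annular
cut-off algebra (`AnnulusCutoffSymbols.lean`), Young's inequality for Schwartz symbols, and
Fatou.
[cite: Rauch1986, Proof of Theorem p. 483, (6); Grafakos2014, Cor. 5.2.8 and Prop. 5.1.16] -/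
theorem isLpMultiplier_of_gradientLpBound_holds : isLpMultiplier_of_gradientLpBound := by
  intro d k k' M hM hbdd p c hp1 hp2 hW
  obtain ⟨C₀r, hC₀r⟩ := hbdd
  set C₀ : ℝ≥0 := C₀r.toNNReal with hC₀def
  have hC : ∀ ξ a b, ‖M ξ a b‖ ≤ (C₀ : ℝ) := fun ξ a b =>
    (hC₀r ξ a b).trans (Real.le_coe_toNNReal C₀r)
  rcases Nat.eq_zero_or_pos d with rfl | hd
  · exact (isLpMultiplierWith_of_finrank_zero hM hC p).isLpMultiplier
  · haveI : Nontrivial (EuclideanSpace ℝ (Fin d)) :=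
      Module.nontrivial_of_finrank_pos (R := ℝ) (by rw [finrank_euclideanSpace_fin]; exact hd)
    have hR : ∀ l : Fin d, ∃ C : ℝ≥0,
        IsLpMultiplierWith p C (fun ξ => rieszSymbol l ξ • (1 : Matrix (Fin k) (Fin k) ℂ)) :=
      fun l => rieszTransform_isLpMultiplier_holds l p hp1 hp2
    choose CR hCR using hR
    exact (isLpMultiplierWith_of_gradientLpBound hM hC hp1 hp2 hW hCR).isLpMultiplier

end Literature.Analysis.Fourier

end
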